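import Literature.MathematicalPhysics.QuantumFieldTheory.Balaban1983to89.B9Eq326GaugeTermSquareZd

/-!
# `Balaban1983to89.B9Eq324DeltaPrimeAZd` — [Balaban1985BackgroundPropagators] (3.24) p. 394 «Δ′_a = Δ′_a(U) = (Δ^η_U + Q′*aQ′)↾_{Ω₀} … Its inverse is
# denoted by G′, or G′(U)» AT THE `ℤᵈ × 𝔸` CARRIERS, AS OBJECTS: the operator `Δ′_a(U₀)` on the real pairing space `L²(Ω₀, ·)` of this seat's Landau files
# (`B9Eq321LandauProjectionZd.suppSub ∕ formE`: functions supported in the finite `Ω₀`, pairing `Σ_x Re τ(f(x)* g(x))`) — `Δ^η_{U₀}` of (3.23) plus the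
# averaging penalty `Σ_{j≤m} a_j Q′_j(U₀)ᵀ 𝟙_{Λ_j} Q′_j(U₀)` with print's own iterated averaging `Q′_j(U₀) = QprimeIter (zdBlocking d L) (bgT L U₀) j` and its
# `τ`-TRANSPOSE taken by RIESZ representation in the finite-dimensional fibre (so that (3.24) «Q′*aQ′ is defined by the same quadratic form» holds BY
# CONSTRUCTION) —, its quadratic form `⟨f, Δ′_a f⟩_τ = ‖D_{U₀}f‖²_τ + Σ_j a_j‖Q′_j f‖²_{τ,Λ_j}`, and THEOREM 3.11's FIRST CLAUSE PROVED AT THE CARRIER: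
# for EVERY unitary background `U₀`, every `a ≥ 0` and every finite `Ω₀` (no smallness), `Δ′_a(U₀)` is positive definite on `L²(Ω₀, ·)`, hence invertible,
# and **`G′(U₀) := (Δ′_a(U₀))⁻¹` IS AN OBJECT** (`GpZd`), positive definite too

statement-level skeleton of published theorems with citation tags; proofs where landed; nothing here is a claim about the
Yang–Mills mass gap

`[Balaban1985BackgroundPropagators]` ("B9", CMP **99** (1985) 389–434) p. 394: *«Let us introduce the operator Δ′_a = Δ′_a(U) = (Δ^η_U + Q′*aQ′)↾_{Ω₀}, where
Q′*aQ′ is defined by the same quadratic form as in (2.14), i.e. ⟨λ, Q′*aQ′λ⟩ = Σ_{j=0}^{k} a_j Σ_{y∈Λ_j} (L^jη)^{d−2}|(Q′_j(U)λ)(y)|², (3.24) the numbers a_j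
satisfy the recursive equations … a > 0. The above operator is considered on the subspace of L², determined by the restriction ↾Ω₀, i.e., on functions
with supports in Ω₀. It can be understood also as Ω₀Δ′_aΩ₀ … Its inverse is denoted by G′, or G′(U). … We do not know yet if the operators in the above
formulas are well defined, e.g. if Δ′_a, Q′G′²Q′* are invertible. It will be proved later (Theorem 3.11) … Assuming some regularity of the configuration
U it can be easily shown that the operator Δ′_a is positive.»*; p. 416, Theorem 3.11: *«the operators Δ′_a, G′, (Q′G′²Q′*)⁻¹, Δ_a, G are positive definite.
This is obvious for the first three operators»*; (3.23) p. 394 *«Δ^η_U = D^{η*}_U D^η_U = Σ_μ D^{η*}_{U,μ}D^η_{U,μ}»*; (3.19) p. 393 (the iterated averaging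
`Q′_j`); p. 391 *«The adjoints are taken with respect to natural L² scalar products … X·Y = tr XY»*.
PDF held: `paper:balaban1985-cmp99-background-propagators` pp. 393–394, 416 (re-read by this seat, 2026-08-28).

CITATION HEADER (lean-in-tree rule).  Cell `pub-ymgap` (YM Track A, HUMAN RULING D-0062 ∕ D-0149 width push), DAG node N06 = [B9], width seat
`pub-ymgap-dag-n06-w4` (g2), `W-SEAT-START-LIST` v8 § n06 ITEM 4 «(γ) Thm 3.3 at a curved U₀ at the carrier: the letters … AS OPERATORS»; this seat's column
is the gauge-fixing sector: `R(U₀)` (g0, `B9Eq321LandauProjectionZd`), `G(U₀)` (g2, `B9Eq327GreenZd`), and here `Δ′_a(U₀) ∕ G′(U₀)` — the operators through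
which print ANALYSES `R` ((3.25) `R = I − G′Q′*(Q′G′²Q′*)⁻¹Q′G′`) and `G` ((3.105)–(3.107)).  At the record's carrier (def-Y's `OpsY`) the analogous objects
are dag-n06-j's ∕ dag-n06-w1's (`B9Thm311DeltaPrimePos`, `B9Thm31Site*Reg335Y`); at the `ℤᵈ` carrier of the J-N06→N05 junction they did not exist.
The carrier, pairing and summation-by-parts are this seat's g0 files BY NAME (`suppSub`, `formE`, `finsum_pair_covLap_eq_sum`, `re_trace_star_pair_invariant`);
the averaging is `B7Eq78Linearization.QprimeIter` with the block transporters `B8Eq119TwistedAxial.bgT` (the letters of g0's `gaugeNull`).  The transpose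
`Q′_jᵀ` is taken ABSTRACTLY — Riesz representation for `Re τ(a* b)` on the finite-dimensional fibre (Mathlib `LinearMap.BilinForm.toDual`) — so NO
unitarity of the averaged transporters `Ū₀ʲ(Γ)` is needed (g0's stencil transpose `QprimeT` is the adjoint only for pairings they leave invariant).

WHAT IS DECLARED ∕ PROVED (kernel, 0 sorry; definitions with bodies + theorems; no `instance`, no `notation`).
* §1 `fibreForm τ` (`(a, b) ↦ Re τ(a* b)` as a real bilinear form on `𝔸`), `fibreForm_comm` (Hermitian `τ`), `fibreForm_nondegenerate` (faithful `τ`),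
  ★ `riesz τ hτp φ` + `fibreForm_riesz` (`Re τ((riesz φ)* b) = φ b`), `riesz_add ∕ _smul`.
* §2 (any index type `ι`) `single i X`, `eq_sum_single` (a finitely supported function is the sum of its single-site parts), `rowFunctional`,
  ★ `transposeOn τ hτp T Λ g` (THE `τ`-TRANSPOSE OF A LINEAR OPERATOR `T` OF `ι → 𝔸` ONTO A FINITE SET `Λ`: `(Tᵀ_Λ g)(i) := riesz (X ↦ Σ_{c∈Λ}
  Re τ((T(single i X))(c)* g(c)))`), `re_trace_transposeOn`, `transposeOn_add ∕ _smul`, ★★ `sum_pair_transposeOn` (THE ADJOINT IDENTITY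
  `Σ_{i∈S} Re τ(f(i)* (Tᵀ_Λ g)(i)) = Σ_{c∈Λ} Re τ((T f)(c)* g(c))` for `f` supported in the finite `S`).
* §3 `QprimeLin L U₀ j` (`Q′_j(U₀)` as an ℝ-linear map of site functions — `QprimeIter_add ∕ _smul`), `covLapLin η U₀` (`Δ^η_{U₀}` as an ℝ-linear map);
  ★ `deltaPrimeAZd τ hτp L m η a Λ U₀` = **`Δ′_a(U₀) := Δ^η_{U₀} + Σ_{j ≤ m} a_j · Q′_j(U₀)ᵀ_{Λ_j} Q′_j(U₀)`** as an ℝ-linear map of site functions (level weights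
  `a j`, print's `a_j(Lʲη)^{d−2}`; level sets `Λ j` as finite site sets); ★ `deltaPrimeADom … s` = **`Ω₀Δ′_aΩ₀`** on `suppSub s` (`s = Ω₀`).
* §4 ★★ `formE_deltaPrimeADom` — THE QUADRATIC FORM (3.23)–(3.24) at a UNITARY background for a tracial Hermitian faithful `τ`:
  `⟨g, Δ′_a f⟩_τ = Σ_μ Σᶠ_x Re τ((D^η_{U₀,μ}g)(x)* (D^η_{U₀,μ}f)(x)) + Σ_{j≤m} a_j Σ_{y∈Λ_j} Re τ((Q′_jg)(y)* (Q′_jf)(y))`; `formE_deltaPrimeADom_symm`;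
  ★★ `formE_deltaPrimeADom_self_nonneg` (`a ≥ 0`); `eq_zero_of_covDerivFwd_eq_zero` (DIRICHLET: a finitely supported `f` with `D^η_{U₀,μ}f ≡ 0` vanishes — any
  background of units, `η ≠ 0`, `0 < d`); ★★★ `formE_deltaPrimeADom_self_eq_zero` (`⟨f, Δ′_a f⟩_τ = 0 ⟹ f = 0`).
* §5 THEOREM 3.11, FIRST CLAUSE, AT THE CARRIER: `finiteDimensional_suppSub'`, ★★★ `deltaPrimeADom_bijective` (EVERY unitary `U₀`, `a ≥ 0`, finite `Ω₀`,
  `0 < d`, `η ≠ 0`, finite-dimensional `𝔸` with a tracial Hermitian faithful `τ` — NO smallness: print's «obvious for the first three operators»),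
  ★ `GpZd …` = **`G′(U₀) := (Ω₀Δ′_aΩ₀)⁻¹`** (a linear equivalence of `L²(Ω₀, ·)`), `GpZd_deltaPrimeADom ∕ deltaPrimeADom_GpZd` (two-sided inverse),
  ★★ `formE_GpZd_self_pos` (`G′(U₀)` is positive definite: `⟨G′f, f⟩_τ > 0` for `f ≠ 0`), `formE_GpZd_symm`.

HONEST SCOPE.  (i) TWO letters of print's gauge-fixing analysis (`Δ′_a`, `G′`) made objects at the `ℤᵈ` carrier and the QUALITATIVE first clause of Theorem
3.11 proved for them (positivity ⟹ invertibility on the finite-dimensional `L²(Ω₀, ·)`); print's clause is UNIFORM positivity with constants («uniformly in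
U, Ω_j», via Theorem 3.1) — NOT claimed; `(Q′G′²Q′*)⁻¹` (needs `Q′` onto), the formula (3.25) for this seat's `R(U₀)`, Theorem 3.1's bounds (3.42)–(3.47) for
`G′` at the carrier, and everything about `Δ_a ∕ G` (Theorem 3.11's second clause — `B9Eq327GreenZd.RegularInClassAt`) are untouched.  (ii) READING: the
penalty's transpose is the `Re τ(a* b)`-adjoint on `L²(Ω₀, ·) × ℓ²(Λ_j, ·)` WITHOUT print's volume weights `η^d ∕ (Lʲη)^d` (absorbed into the displayed level
weights `a j`, as in g0's `QT`); `Λ j` are finite site sets (the member's `Λs m j` at a finite `Ω₀`); unitarity of `U₀` enters only through the adjointness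
`D^{η*} = (D^η)ᵀ` for `Re τ(a* b)` (g0's `finsum_pair_covLap_eq_sum` with `re_trace_star_pair_invariant`); the averaged transporters `bgT` may be arbitrary
units.  (iii) `τ` a PARAMETER (tracial, Hermitian, faithful), `𝔸` finite-dimensional — no instance.  (iv) Count-neutral; N05 ∕ N06 NOT discharged; K1⁷
`stmt-QuantumFields-20542` NOT closed; one finite `𝕋⁴` programme at fixed `ε`, Bałaban as printed; R4 closes only the conditional finite-`𝕋⁴` rung
`BalabanLadder.UV` — nothing continuum ∕ ℝ⁴ ∕ OS ∕ mass gap ∕ Clay.  Unit `pub-ymgap-dag-n06-w4` (g2), 2026-08-28.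
-/

noncomputable section

namespace Literature.MathematicalPhysics.QuantumFieldTheory.Balaban1983to89.B9Eq324DeltaPrimeAZd

open B7Prop1Explicit B7Eq78Linearization
open B7Prop2Explicit (unitaryUnits)
open B8Ineq132 (covDerivFwd covDeriv)
open B8Eq119TwistedAxial (bgT)
open B8Eq138LandauZd (covDivB covLap)
open B9Eq321LandauOrthogonalZd (finsum_pair_covLap_eq_sum support_covDerivFwd_finite)
open B9Eq321LandauProjectionZd (suppSub formE indicator_mem_suppSub formE_apply)
open B9Eq326GaugeTermSquareZd (re_trace_star_pair_invariant)

-- `Site` alone could resolve to the torus sites of `Setup.lean`; re-export the `ℤ^d` sites of `B7Prop1Explicit`.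
export B7Prop1Explicit (Site)

variable {d : ℕ} {𝔸 : Type*} [CStarAlgebra 𝔸]

/-! ## §1  The fibre pairing `Re τ(a* b)` and Riesz representation in the finite-dimensional fibre -/

section Riesz

variable (τ : 𝔸 →ₗ[ℂ] ℂ)

/-- **THE FIBRE PAIRING `(a, b) ↦ Re τ(a* b)`** as a real bilinear form on `𝔸` (print's `X·Y = tr XY` on Hermitian matrices, `|X|² = tr X*X`).
[cite: Balaban1985BackgroundPropagators, p.391 («X·Y = tr XY»), p.390 («|X|² = tr X*X»)] -/
def fibreForm : LinearMap.BilinForm ℝ 𝔸 :=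
  LinearMap.mk₂ ℝ (fun a b => (τ (star a * b)).re)
    (fun a₁ a₂ b => by rw [star_add, add_mul, map_add, Complex.add_re])
    (fun c a b => by
      rw [star_smul, star_trivial, smul_mul_assoc, ← Complex.coe_smul, map_smul, smul_eq_mul, smul_eq_mul, Complex.re_ofReal_mul])
    (fun a b₁ b₂ => by rw [mul_add, map_add, Complex.add_re])
    (fun c a b => by rw [mul_smul_comm, ← Complex.coe_smul, map_smul, smul_eq_mul, smul_eq_mul, Complex.re_ofReal_mul])

/-- the fibre pairing, unfolded. [cite: Balaban1985BackgroundPropagators, p.391 (bookkeeping)] -/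
theorem fibreForm_apply (a b : 𝔸) : fibreForm τ a b = (τ (star a * b)).re := rfl

/-- the fibre pairing is symmetric for a Hermitian `τ` (`τ(a*) = conj τ(a)`). [cite: Balaban1985BackgroundPropagators, p.391 («X·Y = tr XY»)] -/
theorem fibreForm_comm (hτs : ∀ a : 𝔸, τ (star a) = starRingEnd ℂ (τ a)) (a b : 𝔸) : fibreForm τ a b = fibreForm τ b a := by
  rw [fibreForm_apply, fibreForm_apply]
  have h : star b * a = star (star a * b) := by rw [star_mul, star_star]
  rw [h, hτs, Complex.conj_re]

/-- the fibre pairing is invariant under conjugation by UNITARY units, for a tracial `τ` (g0's `re_trace_star_pair_invariant`).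
[cite: Balaban1985BackgroundPropagators, p.391, (3.28) p.395] -/
theorem fibreForm_invariant (hτt : ∀ a b : 𝔸, τ (a * b) = τ (b * a)) :
    ∀ u ∈ unitaryUnits 𝔸, ∀ a b : 𝔸, fibreForm τ (conjR u a) b = fibreForm τ a (conjR u⁻¹ b) :=
  fun _ hu a b => re_trace_star_pair_invariant τ hτt hu a b

/-- **THE FIBRE PAIRING IS NONDEGENERATE** for a faithful `τ` (`Re τ(a*a) > 0` for `a ≠ 0`). [cite: Balaban1985BackgroundPropagators, p.390 («|X|² = tr X*X»)] -/
theorem fibreForm_nondegenerate (hτp : ∀ a : 𝔸, a ≠ 0 → 0 < (τ (star a * a)).re) : (fibreForm τ).Nondegenerate := by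
  refine ⟨fun a ha => ?_, fun a ha => ?_⟩
  · by_contra hne
    exact (hτp a hne).ne' (ha a)
  · by_contra hne
    exact (hτp a hne).ne' (ha a)

variable [FiniteDimensional ℝ 𝔸]

/-- ★ **RIESZ REPRESENTATION IN THE FIBRE**: the vector `riesz τ hτp φ ∈ 𝔸` representing an ℝ-linear functional `φ` for the pairing `Re τ(a* b)`
(finite-dimensional `𝔸`, faithful `τ`; Mathlib's `LinearMap.BilinForm.toDual`). [cite: Balaban1985BackgroundPropagators, p.391 («the adjoints are taken with respect to natural L² scalar products»)] -/
def riesz (hτp : ∀ a : 𝔸, a ≠ 0 → 0 < (τ (star a * a)).re) (φ : 𝔸 →ₗ[ℝ] ℝ) : 𝔸 :=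
  ((fibreForm τ).toDual (fibreForm_nondegenerate τ hτp)).symm φ

/-- **`Re τ((riesz φ)* b) = φ b`.** [cite: Balaban1985BackgroundPropagators, p.391 («the adjoints …»)] -/
theorem fibreForm_riesz (hτp : ∀ a : 𝔸, a ≠ 0 → 0 < (τ (star a * a)).re) (φ : 𝔸 →ₗ[ℝ] ℝ) (b : 𝔸) :
    (τ (star (riesz τ hτp φ) * b)).re = φ b := by
  rw [← fibreForm_apply, riesz]
  exact LinearMap.BilinForm.apply_toDual_symm_apply φ b

/-- `riesz` is additive. [cite: Balaban1985BackgroundPropagators, p.391 (bookkeeping)] -/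
theorem riesz_add (hτp : ∀ a : 𝔸, a ≠ 0 → 0 < (τ (star a * a)).re) (φ ψ : 𝔸 →ₗ[ℝ] ℝ) :
    riesz τ hτp (φ + ψ) = riesz τ hτp φ + riesz τ hτp ψ := by
  rw [riesz, riesz, riesz, map_add]

/-- `riesz` is ℝ-homogeneous. [cite: Balaban1985BackgroundPropagators, p.391 (bookkeeping)] -/
theorem riesz_smul (hτp : ∀ a : 𝔸, a ≠ 0 → 0 < (τ (star a * a)).re) (c : ℝ) (φ : 𝔸 →ₗ[ℝ] ℝ) :
    riesz τ hτp (c • φ) = c • riesz τ hτp φ := by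
  rw [riesz, riesz, map_smul]

end Riesz

/-! ## §2  The `τ`-transpose of a linear operator of `𝔸`-valued functions onto a finite set -/

section Transpose

variable {ι : Type*}

open Classical in
/-- the function with `X` at `i`, `0` elsewhere. [cite: Balaban1985BackgroundPropagators, (3.24) p.394 (bookkeeping)] -/
def single (i : ι) (X : 𝔸) : ι → 𝔸 := fun k => if k = i then X else 0

/-- `single i` is additive. [cite: Balaban1985BackgroundPropagators, (3.24) p.394 (bookkeeping)] -/
theorem single_add (i : ι) (X Y : 𝔸) : single i (X + Y) = single i X + single (ι := ι) i Y := by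
  funext k
  by_cases h : k = i <;> simp [single, h]

/-- `single i` is ℝ-homogeneous. [cite: Balaban1985BackgroundPropagators, (3.24) p.394 (bookkeeping)] -/
theorem single_smul (i : ι) (c : ℝ) (X : 𝔸) : single i (c • X) = c • single (ι := ι) i X := by
  funext k
  by_cases h : k = i <;> simp [single, h]

/-- `single i` as an ℝ-linear map. [cite: Balaban1985BackgroundPropagators, (3.24) p.394 (bookkeeping)] -/
def singleLin (i : ι) : 𝔸 →ₗ[ℝ] (ι → 𝔸) where
  toFun := single i
  map_add' := single_add i
  map_smul' := single_smul i

/-- **A FINITELY SUPPORTED FUNCTION IS THE SUM OF ITS SINGLE-SITE PARTS.** [cite: Balaban1985BackgroundPropagators, (3.24) p.394 (bookkeeping)] -/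
theorem eq_sum_single {f : ι → 𝔸} {S : Finset ι} (hS : ∀ k, f k ≠ 0 → k ∈ S) : f = ∑ i ∈ S, single i (f i) := by
  classical
  funext k
  rw [Finset.sum_apply]
  by_cases h : f k = 0
  · rw [h, eq_comm]
    refine Finset.sum_eq_zero fun i _ => ?_
    by_cases hk : k = i
    · subst hk; simp [single, h]
    · simp [single, hk]
  · rw [Finset.sum_eq_single_of_mem k (hS k h) fun i _ hi => by simp [single, Ne.symm hi]]
    simp [single]

variable (τ : 𝔸 →ₗ[ℂ] ℂ)

/-- the functional `X ↦ Σ_{c∈Λ} Re τ((T(single i X))(c)* g(c))` (ℝ-linear in `X`). [cite: Balaban1985BackgroundPropagators, (3.24) p.394, p.391 («the adjoints …»)] -/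
def rowFunctional (T : (ι → 𝔸) →ₗ[ℝ] (ι → 𝔸)) (Λ : Finset ι) (g : ι → 𝔸) (i : ι) : 𝔸 →ₗ[ℝ] ℝ :=
  (∑ c ∈ Λ, (fibreForm τ).flip (g c) ∘ₗ LinearMap.proj c) ∘ₗ T ∘ₗ singleLin i

/-- the row functional, unfolded. [cite: Balaban1985BackgroundPropagators, (3.24) p.394 (bookkeeping)] -/
theorem rowFunctional_apply (T : (ι → 𝔸) →ₗ[ℝ] (ι → 𝔸)) (Λ : Finset ι) (g : ι → 𝔸) (i : ι) (X : 𝔸) :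
    rowFunctional τ T Λ g i X = ∑ c ∈ Λ, (τ (star (T (single i X) c) * g c)).re := by
  simp only [rowFunctional, LinearMap.coe_comp, Function.comp_apply, LinearMap.coe_sum, Finset.sum_apply, LinearMap.proj_apply]
  rfl

variable [FiniteDimensional ℝ 𝔸] (hτp : ∀ a : 𝔸, a ≠ 0 → 0 < (τ (star a * a)).re)

/-- ★ **THE `τ`-TRANSPOSE `Tᵀ_Λ` OF A LINEAR OPERATOR `T` ONTO THE FINITE SET `Λ`**: `(Tᵀ_Λ g)(i)` is the Riesz vector of
`X ↦ Σ_{c∈Λ} Re τ((T(single i X))(c)* g(c))` — the adjoint of `𝟙_Λ ∘ T` for the unweighted pairings `Σ Re τ(a* b)` (print's `Q′*_j` for `T = Q′_j(U)`, `Λ = Λ_j`,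
up to the constant weights of the `L²` scalar products). [cite: Balaban1985BackgroundPropagators, (3.24) p.394 («Q′*aQ′ is defined by the same quadratic form»), p.391 («the adjoints are taken with respect to natural L² scalar products»)] -/
def transposeOn (T : (ι → 𝔸) →ₗ[ℝ] (ι → 𝔸)) (Λ : Finset ι) (g : ι → 𝔸) : ι → 𝔸 :=
  fun i => riesz τ hτp (rowFunctional τ T Λ g i)

/-- the defining property of the transpose, sitewise: `Re τ((Tᵀ_Λ g)(i)* X) = Σ_{c∈Λ} Re τ((T(single i X))(c)* g(c))`.
[cite: Balaban1985BackgroundPropagators, (3.24) p.394, p.391] -/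
theorem re_trace_transposeOn (T : (ι → 𝔸) →ₗ[ℝ] (ι → 𝔸)) (Λ : Finset ι) (g : ι → 𝔸) (i : ι) (X : 𝔸) :
    (τ (star (transposeOn τ hτp T Λ g i) * X)).re = ∑ c ∈ Λ, (τ (star (T (single i X) c) * g c)).re := by
  rw [transposeOn, fibreForm_riesz, rowFunctional_apply]

/-- `Tᵀ_Λ` is additive in `g`. [cite: Balaban1985BackgroundPropagators, (3.24) p.394 (bookkeeping)] -/
theorem transposeOn_add (T : (ι → 𝔸) →ₗ[ℝ] (ι → 𝔸)) (Λ : Finset ι) (g₁ g₂ : ι → 𝔸) :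
    transposeOn τ hτp T Λ (g₁ + g₂) = transposeOn τ hτp T Λ g₁ + transposeOn τ hτp T Λ g₂ := by
  funext i
  rw [Pi.add_apply, transposeOn, transposeOn, transposeOn, ← riesz_add]
  congr 1
  apply LinearMap.ext
  intro X
  simp only [rowFunctional_apply, LinearMap.add_apply, Pi.add_apply, mul_add, map_add, Complex.add_re, Finset.sum_add_distrib]

/-- `Tᵀ_Λ` is ℝ-homogeneous in `g`. [cite: Balaban1985BackgroundPropagators, (3.24) p.394 (bookkeeping)] -/
theorem transposeOn_smul (T : (ι → 𝔸) →ₗ[ℝ] (ι → 𝔸)) (Λ : Finset ι) (c : ℝ) (g : ι → 𝔸) :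
    transposeOn τ hτp T Λ (c • g) = c • transposeOn τ hτp T Λ g := by
  funext i
  rw [Pi.smul_apply, transposeOn, transposeOn, ← riesz_smul]
  congr 1
  apply LinearMap.ext
  intro X
  rw [LinearMap.smul_apply, rowFunctional_apply, rowFunctional_apply, smul_eq_mul, Finset.mul_sum]
  refine Finset.sum_congr rfl fun c' _ => ?_
  rw [Pi.smul_apply, mul_smul_comm, ← Complex.coe_smul, map_smul, smul_eq_mul, Complex.re_ofReal_mul]

/-- ★★ **THE ADJOINT IDENTITY** (Hermitian `τ`): for `f` supported in a finite `S` and any `g`,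
`Σ_{i∈S} Re τ(f(i)* (Tᵀ_Λ g)(i)) = Σ_{c∈Λ} Re τ((T f)(c)* g(c))` — `Tᵀ_Λ` IS the adjoint of `𝟙_Λ T` on finitely supported functions.
[cite: Balaban1985BackgroundPropagators, (3.24) p.394 («defined by the same quadratic form»), p.391 («the adjoints …»)] -/
theorem sum_pair_transposeOn (hτs : ∀ a : 𝔸, τ (star a) = starRingEnd ℂ (τ a)) (T : (ι → 𝔸) →ₗ[ℝ] (ι → 𝔸)) (Λ : Finset ι) (g : ι → 𝔸)
    {f : ι → 𝔸} {S : Finset ι} (hS : ∀ k, f k ≠ 0 → k ∈ S) :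
    ∑ i ∈ S, (τ (star (f i) * transposeOn τ hτp T Λ g i)).re = ∑ c ∈ Λ, (τ (star (T f c) * g c)).re := by
  have hflip : ∀ i ∈ S, (τ (star (f i) * transposeOn τ hτp T Λ g i)).re = ∑ c ∈ Λ, (τ (star (T (single i (f i)) c) * g c)).re := by
    intro i _
    rw [← fibreForm_apply, fibreForm_comm τ hτs, fibreForm_apply, re_trace_transposeOn]
  rw [Finset.sum_congr rfl hflip, Finset.sum_comm]
  refine Finset.sum_congr rfl fun c _ => ?_
  have hT : T f c = ∑ i ∈ S, T (single i (f i)) c := by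
    conv_lhs => rw [eq_sum_single hS]
    rw [map_sum, Finset.sum_apply]
  rw [hT, star_sum, Finset.sum_mul, map_sum, Complex.re_sum]

end Transpose

/-! ## §3  `Q′_j(U₀)` and `Δ^η_{U₀}` as ℝ-linear maps; `Δ′_a(U₀)` and `Ω₀Δ′_aΩ₀` -/

section Operator

variable (L : ℕ) (U₀ : Site d → Fin d → 𝔸ˣ) (η : ℝ)

/-- **`Q′_j(U₀)` AS AN ℝ-LINEAR MAP** of site functions: `QprimeIter (zdBlocking d L) (bgT L U₀) j` ((3.19): `Q′_j(U) = Q′(Ūʲ⁻¹)⋯Q′(U)`; the letter of g0's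
`gaugeNull`), linear by `QprimeIter_add ∕ _smul`. [cite: Balaban1985BackgroundPropagators, (3.19) p.393] -/
def QprimeLin (j : ℕ) : (Site d → 𝔸) →ₗ[ℝ] (Site d → 𝔸) where
  toFun := QprimeIter (zdBlocking d L) (bgT L U₀) j
  map_add' f g := QprimeIter_add (zdBlocking d L) (bgT L U₀) f g j
  map_smul' c f := by
    have h := QprimeIter_smul (zdBlocking d L) (bgT L U₀) (c : ℂ) f j
    simp only [Complex.coe_smul] at h
    exact h

/-- `QprimeLin`, unfolded. [cite: Balaban1985BackgroundPropagators, (3.19) p.393 (bookkeeping)] -/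
@[simp] theorem QprimeLin_apply (j : ℕ) (f : Site d → 𝔸) : QprimeLin L U₀ j f = QprimeIter (zdBlocking d L) (bgT L U₀) j f := rfl

omit [CStarAlgebra 𝔸] in
/-- the forward covariant derivative is ℝ-homogeneous. [cite: Balaban1985RegularSpaces, (1.1) p.76] -/
private theorem covDerivFwd_smul_real' {𝔸 : Type*} [NormedRing 𝔸] [NormedAlgebra ℂ 𝔸] (η : ℝ) (U₀ : Site d → Fin d → 𝔸ˣ) (μ : Fin d) (c : ℝ)
    (F : Site d → 𝔸) (x : Site d) : covDerivFwd η U₀ μ (c • F) x = c • covDerivFwd η U₀ μ F x := by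
  simp only [covDerivFwd, Pi.smul_apply, conjR_smul_real, ← smul_sub, smul_comm c]

omit [CStarAlgebra 𝔸] in
/-- the backward covariant derivative is ℝ-homogeneous. [cite: Balaban1985RegularSpaces, (1.1) p.76] -/
private theorem covDeriv_smul_real' {𝔸 : Type*} [NormedRing 𝔸] [NormedAlgebra ℂ 𝔸] (η : ℝ) (U₀ : Site d → Fin d → 𝔸ˣ) (ν : Fin d) (c : ℝ)
    (F : Site d → 𝔸) (x : Site d) : covDeriv η U₀ ν (c • F) x = c • covDeriv η U₀ ν F x := by
  simp only [covDeriv, Pi.smul_apply, conjR_smul_real, ← smul_sub, smul_comm c]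

/-- **`Δ^η_{U₀} = D^{η*}_{U₀}D^η_{U₀}` AS AN ℝ-LINEAR MAP** of site functions ((3.23); `B8Eq138LandauZd.covLap`).
[cite: Balaban1985BackgroundPropagators, (3.23) p.394] -/
def covLapLin : (Site d → 𝔸) →ₗ[ℝ] (Site d → 𝔸) where
  toFun := covLap η U₀
  map_add' f g := by
    funext x
    simp only [covLap, covDivB, Pi.add_apply, ← Finset.sum_add_distrib]
    refine Finset.sum_congr rfl fun μ _ => ?_
    have h : (fun z => covDerivFwd η U₀ μ (f + g) z) = (fun z => covDerivFwd η U₀ μ f z) + fun z => covDerivFwd η U₀ μ g z := by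
      funext z; exact B8LambdaSpaceKLevel.covDerivFwd_add' η U₀ μ f g z
    rw [h, B8Eq143PlaqExpansion.covDeriv_add]
  map_smul' c f := by
    funext x
    simp only [covLap, covDivB, Pi.smul_apply, RingHom.id_apply, Finset.smul_sum]
    refine Finset.sum_congr rfl fun μ _ => ?_
    have h : (fun z => covDerivFwd η U₀ μ (c • f) z) = c • fun z => covDerivFwd η U₀ μ f z := by
      funext z; exact covDerivFwd_smul_real' η U₀ μ c f z
    rw [h, covDeriv_smul_real']

/-- `covLapLin`, unfolded. [cite: Balaban1985BackgroundPropagators, (3.23) p.394 (bookkeeping)] -/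
@[simp] theorem covLapLin_apply (f : Site d → 𝔸) : covLapLin U₀ η f = covLap η U₀ f := rfl

variable (s : Finset (Site d))

/-- indicator restriction as a linear map into `suppSub s`. [cite: Balaban1985BackgroundPropagators, (3.24) p.394 («↾Ω₀»)] -/
def restrictSite : (Site d → 𝔸) →ₗ[ℝ] suppSub (𝔸 := 𝔸) s where
  toFun f := ⟨(↑s : Set (Site d)).indicator f, indicator_mem_suppSub s f⟩
  map_add' f g := Subtype.ext (Set.indicator_add _ f g)
  map_smul' c f := Subtype.ext (Set.indicator_const_smul _ c f)

/-- `restrictSite`, unfolded. [cite: Balaban1985BackgroundPropagators, (3.24) p.394 (bookkeeping)] -/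
theorem restrictSite_coe (f : Site d → 𝔸) : (restrictSite s f : Site d → 𝔸) = (↑s : Set (Site d)).indicator f := rfl

variable (τ : 𝔸 →ₗ[ℂ] ℂ) [FiniteDimensional ℝ 𝔸] (hτp : ∀ a : 𝔸, a ≠ 0 → 0 < (τ (star a * a)).re)
variable (m : ℕ) (a : ℕ → ℝ) (Λ : ℕ → Finset (Site d))

/-- ★ **`Δ′_a(U₀) := Δ^η_{U₀} + Σ_{j ≤ m} a_j · Q′_j(U₀)ᵀ 𝟙_{Λ_j} Q′_j(U₀)`** ((3.24), BEFORE the restriction `↾Ω₀`) as an ℝ-linear map of site functions: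
the averaging penalty is the `τ`-transpose (§2) of print's own `Q′_j(U₀)` onto the finite level set `Λ_j`, applied to `Q′_j(U₀)f`, with level weights `a j`
(print: `a_j(Lʲη)^{d−2}`). [cite: Balaban1985BackgroundPropagators, (3.24) p.394, (3.23) p.394, (3.19) p.393] -/
def deltaPrimeAZd : (Site d → 𝔸) →ₗ[ℝ] (Site d → 𝔸) :=
  covLapLin U₀ η + ∑ j ∈ Finset.range (m + 1), a j • (
    { toFun := fun f => transposeOn τ hτp (QprimeLin L U₀ j) (Λ j) (QprimeLin L U₀ j f)
      map_add' := fun f g => by rw [map_add, transposeOn_add]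
      map_smul' := fun c f => by rw [map_smul, transposeOn_smul, RingHom.id_apply] } : (Site d → 𝔸) →ₗ[ℝ] (Site d → 𝔸))

/-- `Δ′_a(U₀)f` at a site, unfolded. [cite: Balaban1985BackgroundPropagators, (3.24) p.394 (bookkeeping)] -/
theorem deltaPrimeAZd_apply (f : Site d → 𝔸) (x : Site d) :
    deltaPrimeAZd L U₀ η τ hτp m a Λ f x =
      covLap η U₀ f x + ∑ j ∈ Finset.range (m + 1),
        a j • transposeOn τ hτp (QprimeLin L U₀ j) (Λ j) (QprimeIter (zdBlocking d L) (bgT L U₀) j f) x := by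
  simp only [deltaPrimeAZd, LinearMap.add_apply, LinearMap.coe_sum, LinearMap.smul_apply, Finset.sum_apply, Pi.add_apply, Pi.smul_apply,
    covLapLin_apply, LinearMap.coe_mk, AddHom.coe_mk, QprimeLin_apply]

/-- ★ **`Ω₀Δ′_a(U₀)Ω₀` ON `L²(Ω₀, ·)`** («The above operator is considered on the subspace of L², determined by the restriction ↾Ω₀ … It can be understood
also as Ω₀Δ′_aΩ₀»): restrict `Δ′_a(U₀)f` to `Ω₀ = s` for `f ∈ suppSub s`. [cite: Balaban1985BackgroundPropagators, (3.24) p.394] -/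
def deltaPrimeADom (s' : Finset (Site d)) : suppSub (𝔸 := 𝔸) s' →ₗ[ℝ] suppSub (𝔸 := 𝔸) s' :=
  (restrictSite s').comp ((deltaPrimeAZd L U₀ η τ hτp m a Λ).domRestrict (suppSub s'))

/-- `Ω₀Δ′_aΩ₀ f`, unfolded. [cite: Balaban1985BackgroundPropagators, (3.24) p.394 (bookkeeping)] -/
theorem deltaPrimeADom_coe (f : suppSub (𝔸 := 𝔸) s) :
    (deltaPrimeADom L U₀ η τ hτp m a Λ s f : Site d → 𝔸) = (↑s : Set (Site d)).indicator (deltaPrimeAZd L U₀ η τ hτp m a Λ f) := rfl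

end Operator

/-! ## §4  The quadratic form: `⟨g, Δ′_a f⟩_τ = Σ_μ ⟨D_μ g, D_μ f⟩_τ + Σ_j a_j ⟨Q′_j g, Q′_j f⟩_{τ,Λ_j}`; positivity; the Dirichlet argument -/

section Form

variable {L : ℕ} {U₀ : Site d → Fin d → 𝔸ˣ} {η : ℝ} (τ : 𝔸 →ₗ[ℂ] ℂ) {s : Finset (Site d)}

/-- for `g ∈ suppSub s`, a `finsum` pairing against `g` is a sum over `s`. [cite: Balaban1985BackgroundPropagators, (3.21) p.394 (bookkeeping)] -/
theorem finsum_pair_eq_sum_of_mem {g : Site d → 𝔸} (hg : g ∈ suppSub (𝔸 := 𝔸) s) (h : Site d → 𝔸) :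
    ∑ᶠ x, (τ (star (g x) * h x)).re = ∑ x ∈ s, (τ (star (g x) * h x)).re := by
  refine finsum_eq_sum_of_support_subset _ fun x hx => ?_
  rw [Function.mem_support] at hx
  rw [Finset.mem_coe]
  by_contra hxs
  exact hx (by rw [hg x hxs, star_zero, zero_mul, map_zero, Complex.zero_re])

/-- a function of `suppSub s` is finitely supported. [cite: Balaban1985BackgroundPropagators, (3.21) p.394 (bookkeeping)] -/
theorem support_finite_of_mem {g : Site d → 𝔸} (hg : g ∈ suppSub (𝔸 := 𝔸) s) : (Function.support g).Finite :=
  s.finite_toSet.subset fun x hx => by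
    rw [Function.mem_support] at hx
    by_contra hxs
    exact hx (hg x hxs)

/-- each diagonal term `Re τ(a* a)` is non-negative for a faithful positive trace. [folklore] -/
private theorem re_trace_star_mul_self_nonneg (hτp : ∀ a : 𝔸, a ≠ 0 → 0 < (τ (star a * a)).re) (b : 𝔸) : 0 ≤ (τ (star b * b)).re := by
  by_cases hb : b = 0
  · rw [hb, mul_zero, map_zero, Complex.zero_re]
  · exact (hτp b hb).le

/-- `conjR u 0 = 0`. [folklore] -/
private theorem conjR_zero' (u : 𝔸ˣ) : conjR u (0 : 𝔸) = 0 := by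
  rw [conjR_apply, mul_zero, zero_mul]

/-- **THE DIRICHLET ARGUMENT**: a FINITELY SUPPORTED site function with `D^η_{U₀,μ}f ≡ 0` in some direction `μ` vanishes — covariant constancy along the
`μ`-lines propagates a non-zero value to infinity (any background of units; `η ≠ 0`). [cite: Balaban1985BackgroundPropagators, (3.24) p.394 («on functions with supports in Ω₀»), p.416 (Thm 3.11)] -/
theorem eq_zero_of_covDerivFwd_eq_zero (hη : η ≠ 0) (μ : Fin d) {f : Site d → 𝔸} (hf : (Function.support f).Finite)
    (h : ∀ x, covDerivFwd η U₀ μ f x = 0) : f = 0 := by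
  by_contra hne
  obtain ⟨x₀, hx₀⟩ := Function.ne_iff.1 hne
  -- along the `μ`-line through `x₀` the function never vanishes
  have hstep : ∀ x, f x ≠ 0 → f (x + e μ) ≠ 0 := by
    intro x hx hzero
    have hx' := h x
    rw [covDerivFwd, hzero, conjR_zero', zero_sub, smul_neg, neg_eq_zero, smul_eq_zero] at hx'
    exact hx'.elim (fun h1 => hη (inv_eq_zero.1 h1)) hx
  have hline : ∀ n : ℕ, f (x₀ + (n : ℤ) • e μ) ≠ 0 := by
    intro n
    induction n with
    | zero => simpa using hx₀
    | succ n ih =>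
      have := hstep _ ih
      rwa [add_assoc, ← add_one_zsmul, ← Nat.cast_succ] at this
  -- the line is injective into the support: contradiction with finiteness
  have hinj : Function.Injective fun n : ℕ => x₀ + (n : ℤ) • e μ := by
    intro n₁ n₂ hn
    have h' : ((n₁ : ℤ) • e μ) μ = ((n₂ : ℤ) • e μ) μ := by
      have := congr_fun (add_left_cancel (a := x₀) hn) μ
      exact this
    simpa [e] using h'
  have hsub : Set.range (fun n : ℕ => x₀ + (n : ℤ) • e μ) ⊆ Function.support f := by
    rintro y ⟨n, rfl⟩
    exact Function.mem_support.2 (hline n)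
  exact (hf.subset hsub).not_infinite (Set.infinite_range_of_injective hinj)

variable [FiniteDimensional ℝ 𝔸] (hτp : ∀ a : 𝔸, a ≠ 0 → 0 < (τ (star a * a)).re) {m : ℕ} {a : ℕ → ℝ} {Λ : ℕ → Finset (Site d)}

/-- ★★ **THE QUADRATIC FORM (3.23)–(3.24) AT A UNITARY BACKGROUND**: for `f, g ∈ L²(Ω₀, ·)`, a tracial Hermitian faithful `τ`,
`⟨g, Ω₀Δ′_a(U₀)Ω₀ f⟩_τ = Σ_μ Σᶠ_x Re τ((D^η_{U₀,μ}g)(x)* (D^η_{U₀,μ}f)(x)) + Σ_{j ≤ m} a_j Σ_{y∈Λ_j} Re τ((Q′_j g)(y)* (Q′_j f)(y))` — the Laplacian part by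
summation by parts (g0's `finsum_pair_covLap_eq_sum`, unitary `U₀`), the penalty by the adjoint identity of §2 (no condition on the averaged transporters).
[cite: Balaban1985BackgroundPropagators, (3.23)–(3.24) p.394] -/
theorem formE_deltaPrimeADom (hτt : ∀ a b : 𝔸, τ (a * b) = τ (b * a)) (hτs : ∀ a : 𝔸, τ (star a) = starRingEnd ℂ (τ a))
    (hU : ∀ (x : Site d) (κ : Fin d), U₀ x κ ∈ unitaryUnits 𝔸) (f g : suppSub (𝔸 := 𝔸) s) :
    formE τ s g (deltaPrimeADom L U₀ η τ hτp m a Λ s f) =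
      (∑ μ : Fin d, ∑ᶠ x, (τ (star (covDerivFwd η U₀ μ (g : Site d → 𝔸) x) * covDerivFwd η U₀ μ (f : Site d → 𝔸) x)).re) +
        ∑ j ∈ Finset.range (m + 1), a j * ∑ y ∈ Λ j,
          (τ (star (QprimeIter (zdBlocking d L) (bgT L U₀) j (g : Site d → 𝔸) y) * QprimeIter (zdBlocking d L) (bgT L U₀) j (f : Site d → 𝔸) y)).re := by
  have hgfin := support_finite_of_mem g.2
  have hffin := support_finite_of_mem f.2
  -- drop the indicator on `s` and pass to `finsum`
  have h1 : formE τ s g (deltaPrimeADom L U₀ η τ hτp m a Λ s f) =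
      ∑ x ∈ s, (τ (star ((g : Site d → 𝔸) x) * deltaPrimeAZd L U₀ η τ hτp m a Λ f x)).re := by
    rw [formE_apply]
    refine Finset.sum_congr rfl fun x hx => ?_
    rw [deltaPrimeADom_coe, Set.indicator_of_mem (Finset.mem_coe.2 hx)]
  rw [h1, ← finsum_pair_eq_sum_of_mem τ g.2]
  -- split `Δ′_a = Δ^η + penalty` under the finsum
  have hsplit : ∀ x, (τ (star ((g : Site d → 𝔸) x) * deltaPrimeAZd L U₀ η τ hτp m a Λ f x)).re =
      (τ (star ((g : Site d → 𝔸) x) * covLap η U₀ f x)).re +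
        ∑ j ∈ Finset.range (m + 1), a j * (τ (star ((g : Site d → 𝔸) x) *
          transposeOn τ hτp (QprimeLin L U₀ j) (Λ j) (QprimeIter (zdBlocking d L) (bgT L U₀) j f) x)).re := by
    intro x
    rw [deltaPrimeAZd_apply, mul_add, map_add, Complex.add_re, Finset.mul_sum, map_sum, Complex.re_sum]
    refine congrArg _ (Finset.sum_congr rfl fun j _ => ?_)
    rw [mul_smul_comm, ← Complex.coe_smul, map_smul, smul_eq_mul, Complex.re_ofReal_mul]
  have hsupp : ∀ h : Site d → 𝔸, (Function.support fun x => (τ (star ((g : Site d → 𝔸) x) * h x)).re).Finite := by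
    intro h
    refine hgfin.subset fun x hx => ?_
    rw [Function.mem_support] at hx ⊢
    intro h0
    exact hx (by rw [h0, star_zero, zero_mul, map_zero, Complex.zero_re])
  have hsupp2 : (Function.support fun x => ∑ j ∈ Finset.range (m + 1), a j * (τ (star ((g : Site d → 𝔸) x) *
      transposeOn τ hτp (QprimeLin L U₀ j) (Λ j) (QprimeIter (zdBlocking d L) (bgT L U₀) j f) x)).re).Finite := by
    refine hgfin.subset fun x hx => ?_
    rw [Function.mem_support] at hx ⊢
    intro h0
    exact hx (Finset.sum_eq_zero fun j _ => by rw [h0, star_zero, zero_mul, map_zero, Complex.zero_re, mul_zero])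
  rw [finsum_congr hsplit, finsum_add_distrib (hsupp _) hsupp2]
  congr 1
  · -- the Laplacian part: g0's summation by parts for the `Re τ(a* b)` pairing (unitary `U₀`)
    have h := finsum_pair_covLap_eq_sum (fibreForm τ) (unitaryUnits 𝔸) η U₀ (fibreForm_invariant τ hτt) hU hffin hgfin
    simp only [fibreForm_apply] at h
    exact h
  · -- the penalty: a finite sum of levels, each by the adjoint identity
    rw [finsum_eq_sum_of_support_subset _ (s := s) (fun x hx => ?_)]
    · rw [Finset.sum_comm]
      refine Finset.sum_congr rfl fun j _ => ?_
      rw [← Finset.mul_sum, sum_pair_transposeOn τ hτp hτs (QprimeLin L U₀ j) (Λ j) _ (S := s) (fun k hk => ?_)]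
      · rfl
      · by_contra hks
        exact hk (g.2 k (fun h => hks h))
    · rw [Function.mem_support] at hx
      rw [Finset.mem_coe]
      by_contra hxs
      exact hx (Finset.sum_eq_zero fun j _ => by rw [g.2 x hxs, star_zero, zero_mul, map_zero, Complex.zero_re, mul_zero])

/-- **`Ω₀Δ′_a(U₀)Ω₀` IS SYMMETRIC for the pairing**: `⟨g, Δ′_a f⟩_τ = ⟨f, Δ′_a g⟩_τ` (Hermitian `τ`, unitary `U₀`).
[cite: Balaban1985BackgroundPropagators, (3.24) p.394, p.416 («It is a symmetric and invertible operator»)] -/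
theorem formE_deltaPrimeADom_symm (hτt : ∀ a b : 𝔸, τ (a * b) = τ (b * a)) (hτs : ∀ a : 𝔸, τ (star a) = starRingEnd ℂ (τ a))
    (hU : ∀ (x : Site d) (κ : Fin d), U₀ x κ ∈ unitaryUnits 𝔸) (f g : suppSub (𝔸 := 𝔸) s) :
    formE τ s g (deltaPrimeADom L U₀ η τ hτp m a Λ s f) = formE τ s f (deltaPrimeADom L U₀ η τ hτp m a Λ s g) := by
  rw [formE_deltaPrimeADom τ hτp hτt hτs hU f g, formE_deltaPrimeADom τ hτp hτt hτs hU g f]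
  congr 1
  · refine Finset.sum_congr rfl fun μ _ => finsum_congr fun x => ?_
    rw [← fibreForm_apply, fibreForm_comm τ hτs, fibreForm_apply]
  · refine Finset.sum_congr rfl fun j _ => ?_
    congr 1
    refine Finset.sum_congr rfl fun y _ => ?_
    rw [← fibreForm_apply, fibreForm_comm τ hτs, fibreForm_apply]

/-- ★★ **`⟨f, Ω₀Δ′_a(U₀)Ω₀ f⟩_τ ≥ 0`** for `a ≥ 0` at a unitary background («the operator Δ′_a is positive»).
[cite: Balaban1985BackgroundPropagators, p.394 («it can be easily shown that the operator Δ′_a is positive»), Thm 3.11 p.416] -/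
theorem formE_deltaPrimeADom_self_nonneg (hτt : ∀ a b : 𝔸, τ (a * b) = τ (b * a)) (hτs : ∀ a : 𝔸, τ (star a) = starRingEnd ℂ (τ a))
    (hU : ∀ (x : Site d) (κ : Fin d), U₀ x κ ∈ unitaryUnits 𝔸) (ha : ∀ j, 0 ≤ a j) (f : suppSub (𝔸 := 𝔸) s) :
    0 ≤ formE τ s f (deltaPrimeADom L U₀ η τ hτp m a Λ s f) := by
  rw [formE_deltaPrimeADom τ hτp hτt hτs hU f f]
  refine add_nonneg (Finset.sum_nonneg fun μ _ => finsum_nonneg fun x => re_trace_star_mul_self_nonneg τ hτp _)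
    (Finset.sum_nonneg fun j _ => mul_nonneg (ha j) (Finset.sum_nonneg fun y _ => re_trace_star_mul_self_nonneg τ hτp _))

/-- ★★★ **`⟨f, Ω₀Δ′_a(U₀)Ω₀ f⟩_τ = 0 ⟹ f = 0` ON `L²(Ω₀, ·)`** — `Δ′_a(U₀)` IS POSITIVE DEFINITE for EVERY unitary `U₀`, `a ≥ 0`, finite `Ω₀` (`0 < d`,
`η ≠ 0`): the form dominates `Σ_μ ‖D^η_{U₀,μ}f‖²_τ`, each `D^η_{U₀,μ}f` vanishes, and the Dirichlet argument ends it.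
[cite: Balaban1985BackgroundPropagators, Thm 3.11 p.416 («Δ′_a, G′ … are positive definite. This is obvious»), p.394] -/
theorem formE_deltaPrimeADom_self_eq_zero (hd : 0 < d) (hη : η ≠ 0) (hτt : ∀ a b : 𝔸, τ (a * b) = τ (b * a))
    (hτs : ∀ a : 𝔸, τ (star a) = starRingEnd ℂ (τ a))
    (hU : ∀ (x : Site d) (κ : Fin d), U₀ x κ ∈ unitaryUnits 𝔸) (ha : ∀ j, 0 ≤ a j) {f : suppSub (𝔸 := 𝔸) s}
    (h0 : formE τ s f (deltaPrimeADom L U₀ η τ hτp m a Λ s f) = 0) : f = 0 := by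
  rw [formE_deltaPrimeADom τ hτp hτt hτs hU f f] at h0
  have hffin := support_finite_of_mem f.2
  have hD : ∀ μ, 0 ≤ ∑ᶠ x, (τ (star (covDerivFwd η U₀ μ (f : Site d → 𝔸) x) * covDerivFwd η U₀ μ (f : Site d → 𝔸) x)).re :=
    fun μ => finsum_nonneg fun x => re_trace_star_mul_self_nonneg τ hτp _
  have hP : 0 ≤ ∑ j ∈ Finset.range (m + 1), a j * ∑ y ∈ Λ j, (τ (star (QprimeIter (zdBlocking d L) (bgT L U₀) j (f : Site d → 𝔸) y) *
      QprimeIter (zdBlocking d L) (bgT L U₀) j (f : Site d → 𝔸) y)).re :=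
    Finset.sum_nonneg fun j _ => mul_nonneg (ha j) (Finset.sum_nonneg fun y _ => re_trace_star_mul_self_nonneg τ hτp _)
  have hDsum : ∑ μ : Fin d, ∑ᶠ x, (τ (star (covDerivFwd η U₀ μ (f : Site d → 𝔸) x) * covDerivFwd η U₀ μ (f : Site d → 𝔸) x)).re = 0 := by
    have := Finset.sum_nonneg fun μ (_ : μ ∈ (Finset.univ : Finset (Fin d))) => hD μ
    linarith
  -- the direction `μ₀ = 0` (`0 < d`)
  let μ₀ : Fin d := ⟨0, hd⟩
  have hμ₀ : ∑ᶠ x, (τ (star (covDerivFwd η U₀ μ₀ (f : Site d → 𝔸) x) * covDerivFwd η U₀ μ₀ (f : Site d → 𝔸) x)).re = 0 :=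
    (Finset.sum_eq_zero_iff_of_nonneg fun μ _ => hD μ).1 hDsum μ₀ (Finset.mem_univ _)
  have hsuppD := support_covDerivFwd_finite η U₀ μ₀ hffin
  have hsub : (Function.support fun x => (τ (star (covDerivFwd η U₀ μ₀ (f : Site d → 𝔸) x) * covDerivFwd η U₀ μ₀ (f : Site d → 𝔸) x)).re) ⊆
      ↑hsuppD.toFinset := by
    intro x hx
    rw [Set.Finite.coe_toFinset, Function.mem_support]
    intro h0'
    rw [Function.mem_support, h0', star_zero, zero_mul, map_zero, Complex.zero_re] at hx
    exact hx rfl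
  rw [finsum_eq_sum_of_support_subset _ hsub] at hμ₀
  have hall : ∀ x, covDerivFwd η U₀ μ₀ (f : Site d → 𝔸) x = 0 := by
    intro x
    by_contra hx
    have hmem : x ∈ hsuppD.toFinset := by rw [Set.Finite.mem_toFinset, Function.mem_support]; exact hx
    have := (Finset.sum_eq_zero_iff_of_nonneg fun y _ => re_trace_star_mul_self_nonneg τ hτp _).1 hμ₀ x hmem
    exact (hτp _ hx).ne' this
  exact Subtype.ext (eq_zero_of_covDerivFwd_eq_zero hη μ₀ hffin hall)

end Form

/-! ## §5  Theorem 3.11, first clause, at the carrier: `Ω₀Δ′_aΩ₀` is invertible; `G′(U₀) := (Ω₀Δ′_aΩ₀)⁻¹` as an object -/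

section GreenPrime

variable (L : ℕ) (U₀ : Site d → Fin d → 𝔸ˣ) (η : ℝ) (τ : 𝔸 →ₗ[ℂ] ℂ) [FiniteDimensional ℝ 𝔸]
  (hτp : ∀ a : 𝔸, a ≠ 0 → 0 < (τ (star a * a)).re) (m : ℕ) (a : ℕ → ℝ) (Λ : ℕ → Finset (Site d)) (s : Finset (Site d))

/-- **`L²(Ω₀, ·)` IS FINITE-DIMENSIONAL** (restriction to the finite `s` is injective; g0's private lemma, re-proved).
[cite: Balaban1985BackgroundPropagators, (3.21) p.394 («the Hilbert space L²(Ω₀, 𝔤)»)] -/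
theorem finiteDimensional_suppSub' : FiniteDimensional ℝ (suppSub (𝔸 := 𝔸) s) := by
  let res : (suppSub (𝔸 := 𝔸) s) →ₗ[ℝ] ((↥s) → 𝔸) :=
    { toFun := fun f x => (f : Site d → 𝔸) x
      map_add' := fun f g => rfl
      map_smul' := fun c f => rfl }
  refine FiniteDimensional.of_injective res fun f g h => ?_
  apply Subtype.ext
  funext x
  by_cases hx : x ∈ s
  · exact congr_fun h ⟨x, hx⟩
  · rw [f.2 x hx, g.2 x hx]

/-- ★★★ **THEOREM 3.11, FIRST CLAUSE, AT THE `ℤᵈ` CARRIER: `Ω₀Δ′_a(U₀)Ω₀` IS INVERTIBLE ON `L²(Ω₀, ·)`** for EVERY unitary background `U₀`, every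
`a ≥ 0`, every finite `Ω₀` (`0 < d`, `η ≠ 0`; `𝔸` finite-dimensional with a tracial Hermitian faithful `τ`) — positive definite (§4) ⟹ injective ⟹ (finite
dimension) bijective.  NO smallness of `U₀` is used (print: «obvious for the first three operators»); print's clause is moreover UNIFORM — not claimed.
[cite: Balaban1985BackgroundPropagators, Thm 3.11 p.416, p.394 («if Δ′_a … are invertible. It will be proved later»)] -/
theorem deltaPrimeADom_bijective (hd : 0 < d) (hη : η ≠ 0) (hτt : ∀ a b : 𝔸, τ (a * b) = τ (b * a))
    (hτs : ∀ a : 𝔸, τ (star a) = starRingEnd ℂ (τ a)) (hU : ∀ (x : Site d) (κ : Fin d), U₀ x κ ∈ unitaryUnits 𝔸) (ha : ∀ j, 0 ≤ a j) :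
    Function.Bijective (deltaPrimeADom L U₀ η τ hτp m a Λ s) := by
  haveI := finiteDimensional_suppSub' (𝔸 := 𝔸) s
  have hinj : Function.Injective (deltaPrimeADom L U₀ η τ hτp m a Λ s) := by
    rw [← LinearMap.ker_eq_bot, Submodule.eq_bot_iff]
    intro f hf
    rw [LinearMap.mem_ker] at hf
    refine formE_deltaPrimeADom_self_eq_zero (L := L) (m := m) (Λ := Λ) τ hτp hd hη hτt hτs hU ha ?_
    rw [hf, map_zero]
  exact ⟨hinj, LinearMap.injective_iff_surjective.1 hinj⟩

/-- ★ **`G′(U₀) := (Ω₀Δ′_a(U₀)Ω₀)⁻¹` AS AN OBJECT** — a linear equivalence of `L²(Ω₀, ·)` («Its inverse is denoted by G′, or G′(U)»), for every unitary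
`U₀`, `a ≥ 0`, finite `Ω₀`. [cite: Balaban1985BackgroundPropagators, (3.24) p.394, Thm 3.11 p.416] -/
def GpZd (hd : 0 < d) (hη : η ≠ 0) (hτt : ∀ a b : 𝔸, τ (a * b) = τ (b * a)) (hτs : ∀ a : 𝔸, τ (star a) = starRingEnd ℂ (τ a))
    (hU : ∀ (x : Site d) (κ : Fin d), U₀ x κ ∈ unitaryUnits 𝔸) (ha : ∀ j, 0 ≤ a j) :
    suppSub (𝔸 := 𝔸) s ≃ₗ[ℝ] suppSub (𝔸 := 𝔸) s :=
  (LinearEquiv.ofBijective _ (deltaPrimeADom_bijective L U₀ η τ hτp m a Λ s hd hη hτt hτs hU ha)).symm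

variable {L U₀ η τ hτp m a Λ s}

/-- **`G′(U₀)(Ω₀Δ′_aΩ₀ f) = f`.** [cite: Balaban1985BackgroundPropagators, (3.24) p.394] -/
theorem GpZd_deltaPrimeADom (hd : 0 < d) (hη : η ≠ 0) (hτt : ∀ a b : 𝔸, τ (a * b) = τ (b * a))
    (hτs : ∀ a : 𝔸, τ (star a) = starRingEnd ℂ (τ a)) (hU : ∀ (x : Site d) (κ : Fin d), U₀ x κ ∈ unitaryUnits 𝔸) (ha : ∀ j, 0 ≤ a j)
    (f : suppSub (𝔸 := 𝔸) s) : GpZd L U₀ η τ hτp m a Λ s hd hη hτt hτs hU ha (deltaPrimeADom L U₀ η τ hτp m a Λ s f) = f := by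
  rw [GpZd, ← LinearEquiv.ofBijective_apply (hf := deltaPrimeADom_bijective L U₀ η τ hτp m a Λ s hd hη hτt hτs hU ha), LinearEquiv.symm_apply_apply]

/-- **`Ω₀Δ′_aΩ₀ (G′(U₀) f) = f`.** [cite: Balaban1985BackgroundPropagators, (3.24) p.394] -/
theorem deltaPrimeADom_GpZd (hd : 0 < d) (hη : η ≠ 0) (hτt : ∀ a b : 𝔸, τ (a * b) = τ (b * a))
    (hτs : ∀ a : 𝔸, τ (star a) = starRingEnd ℂ (τ a)) (hU : ∀ (x : Site d) (κ : Fin d), U₀ x κ ∈ unitaryUnits 𝔸) (ha : ∀ j, 0 ≤ a j)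
    (f : suppSub (𝔸 := 𝔸) s) : deltaPrimeADom L U₀ η τ hτp m a Λ s (GpZd L U₀ η τ hτp m a Λ s hd hη hτt hτs hU ha f) = f := by
  rw [GpZd, ← LinearEquiv.ofBijective_apply (hf := deltaPrimeADom_bijective L U₀ η τ hτp m a Λ s hd hη hτt hτs hU ha), LinearEquiv.apply_symm_apply]

/-- ★★ **`G′(U₀)` IS POSITIVE DEFINITE**: `⟨G′f, f⟩_τ = ⟨G′f, Ω₀Δ′_aΩ₀(G′f)⟩_τ > 0` for `f ≠ 0` («the operators Δ′_a, G′ … are positive definite»).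
[cite: Balaban1985BackgroundPropagators, Thm 3.11 p.416] -/
theorem formE_GpZd_self_pos (hd : 0 < d) (hη : η ≠ 0) (hτt : ∀ a b : 𝔸, τ (a * b) = τ (b * a))
    (hτs : ∀ a : 𝔸, τ (star a) = starRingEnd ℂ (τ a)) (hU : ∀ (x : Site d) (κ : Fin d), U₀ x κ ∈ unitaryUnits 𝔸) (ha : ∀ j, 0 ≤ a j)
    {f : suppSub (𝔸 := 𝔸) s} (hf : f ≠ 0) :
    0 < formE τ s (GpZd L U₀ η τ hτp m a Λ s hd hη hτt hτs hU ha f) f := by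
  set g := GpZd L U₀ η τ hτp m a Λ s hd hη hτt hτs hU ha f with hg
  have hfg : f = deltaPrimeADom L U₀ η τ hτp m a Λ s g := (deltaPrimeADom_GpZd hd hη hτt hτs hU ha f).symm
  have hg0 : g ≠ 0 := by
    intro h0
    apply hf
    rw [hfg, h0, map_zero]
  rw [hfg]
  rcases (formE_deltaPrimeADom_self_nonneg (L := L) (m := m) (Λ := Λ) τ hτp hτt hτs hU ha g).lt_or_eq with hlt | heq
  · exact hlt
  · exact absurd (formE_deltaPrimeADom_self_eq_zero (L := L) (m := m) (Λ := Λ) τ hτp hd hη hτt hτs hU ha heq.symm) hg0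

/-- **`G′(U₀)` IS SYMMETRIC for the pairing**: `⟨G′u, v⟩_τ = ⟨u, G′v⟩_τ` (Hermitian `τ`, unitary `U₀`) — from the symmetry of `Δ′_a` and of the pairing.
[cite: Balaban1985BackgroundPropagators, (3.24)–(3.25) p.394, p.416] -/
theorem formE_GpZd_symm (hd : 0 < d) (hη : η ≠ 0) (hτt : ∀ a b : 𝔸, τ (a * b) = τ (b * a))
    (hτs : ∀ a : 𝔸, τ (star a) = starRingEnd ℂ (τ a)) (hU : ∀ (x : Site d) (κ : Fin d), U₀ x κ ∈ unitaryUnits 𝔸) (ha : ∀ j, 0 ≤ a j)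
    (u v : suppSub (𝔸 := 𝔸) s) :
    formE τ s (GpZd L U₀ η τ hτp m a Λ s hd hη hτt hτs hU ha u) v = formE τ s u (GpZd L U₀ η τ hτp m a Λ s hd hη hτt hτs hU ha v) := by
  set Gu := GpZd L U₀ η τ hτp m a Λ s hd hη hτt hτs hU ha u
  set Gv := GpZd L U₀ η τ hτp m a Λ s hd hη hτt hτs hU ha v
  have hu : u = deltaPrimeADom L U₀ η τ hτp m a Λ s Gu := (deltaPrimeADom_GpZd hd hη hτt hτs hU ha u).symm
  have hv : v = deltaPrimeADom L U₀ η τ hτp m a Λ s Gv := (deltaPrimeADom_GpZd hd hη hτt hτs hU ha v).symm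
  conv_lhs => rw [hv]
  conv_rhs => rw [hu]
  rw [formE_deltaPrimeADom_symm (L := L) (m := m) (Λ := Λ) τ hτp hτt hτs hU Gv Gu,
    (B9Eq321LandauProjectionZd.formE_isSymm τ s hτs).eq Gv (deltaPrimeADom L U₀ η τ hτp m a Λ s Gu)]

end GreenPrime

end Literature.MathematicalPhysics.QuantumFieldTheory.Balaban1983to89.B9Eq324DeltaPrimeAZd

end
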